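import Mathlib.MeasureTheory.Measure.Lebesgue.VolumeOfBalls
import Mathlib.MeasureTheory.Measure.Haar.InnerProductSpace
import Mathlib.MeasureTheory.Integral.IntervalIntegral.Periodic
import Literature.Analysis.FunctionSpaces.TorusPairDist
import Literature.MathematicalPhysics.QuantumManyBody.TorusSlotShiftDirichlet
-- module: Summits.AtomisticToContinuum.BoseEinsteinCondensation.Theorems.BECRewardDescentRewardChordBoundFreeRegionSpreadingGeometry

/-!
# Stub R3 `stub_freeRegionSpreading` of crux `RewardChordBound` (stmt-AtomisticToContinuum-12876), helpers II:
# parking geometry in the free region of the configuration torus `(ℝ/ℤ)^{N×3}`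

Deterministic geometry of the **free region** `U₀(b) = {t | ∀ j ≠ l, b < ρⱼₗ(t)}` (`ρ = Torus.pairDist`, the
nearest-image pair distance `ρⱼₗ(t) = (∑ₖ ‖t(j,k) - t(l,k)‖²)^{1/2}`) under the parking-room condition
`2N · (4π/3) b³ < 1`:

* `haar_normBall_le` — the Haar probability of a nearest-image ball `{p | ∑ₖ ‖pₖ - qₖ‖² ≤ r²}` of `(ℝ/ℤ)³`
  is at most the Euclidean volume `(4π/3) r³` (lift to the fundamental cube `(-1/2, 1/2]³`, where the quotient
  norm is the absolute value; `AddCircle.measurePreserving_mk`, `EuclideanSpace.volume_closedBall_fin_three`);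
* `exists_far` — finitely many points `S` with `#S · (4π/3) b³ < 1` leave a spot at distance `> b` from all;
* `exists_parking` — for configurations `X`, `Y` there is a free parking configuration `P` whose spot `pⱼ` is
  `b`-far from the particles `xₗ`, `l > j`, and whose spot `pₗ` is `b`-far from the particles `yⱼ`, `j < l`
  (chosen one at a time, each avoiding `≤ 2N - 2` balls of total measure `< 1`);
* `splice_succ`, `free_splice`, `exists_chain` — hence the splices `(p₀, …, p_{k-1}, x_k, …)` (park `X`) and
  `(y₀, …, y_{k-1}, p_k, …)` (un-park onto `Y`) are free, consecutive ones differ by a one-slot shift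
  `σᵢ c = BoseGas.slotShift i c`, and so any two free configurations are joined by a finite chain of one-slot
  moves through the free region (`exists_chain`).

No new definitions: the free region and the splices are written out.
-/

noncomputable section

open MeasureTheory Filter Set Function Metric
open scoped ENNReal NNReal Topology
open Literature.Analysis.FunctionSpaces
open Literature.MathematicalPhysics.QuantumManyBody.BoseGas

namespace Summit.AtomisticToContinuum.BoseEinsteinCondensation.Cruxes.RewardChordBound.Birth.FreeRegionSpreading

variable {N : ℕ}

section Spots

/-- The squared nearest-image distance of `(ℝ/ℤ)³` is symmetric. [folklore] -/
theorem sum_norm_sub_sq_comm (u v : UnitAddTorus (Fin 3)) : ∑ k, ‖u k - v k‖ ^ 2 = ∑ k, ‖v k - u k‖ ^ 2 :=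
  Finset.sum_congr rfl fun k _ => by rw [← norm_neg, neg_sub]

/-- **Haar measure of a nearest-image ball in `(ℝ/ℤ)³`** is at most the Euclidean volume `(4π/3) r³` (lift to the
fundamental cube `(-1/2, 1/2]³`, on which the quotient norm is the absolute value). [folklore] -/
theorem haar_normBall_le (q : UnitAddTorus (Fin 3)) {r : ℝ} (hr : 0 ≤ r) :
    Measure.pi (fun _ : Fin 3 => (AddCircle.haarAddCircle : Measure UnitAddCircle))
        {p | ∑ k, ‖p k - q k‖ ^ 2 ≤ r ^ 2} ≤ ENNReal.ofReal r ^ 3 * ENNReal.ofReal (Real.pi * 4 / 3) := by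
  -- translate to `q = 0`
  have h1 : {p : UnitAddTorus (Fin 3) | ∑ k, ‖p k - q k‖ ^ 2 ≤ r ^ 2} =
      (fun p => p + -q) ⁻¹' {p | ∑ k, ‖p k‖ ^ 2 ≤ r ^ 2} := by
    ext p
    simp only [mem_setOf_eq, mem_preimage, ← sub_eq_add_neg, Pi.sub_apply]
  rw [h1, measure_preimage_add_right]
  -- the fundamental cube
  set I : Set ℝ := Ioc (-(1 / 2 : ℝ)) (-(1 / 2) + 1) with hI
  have hmk1 : MeasurePreserving ((↑) : ℝ → UnitAddCircle) ((volume : Measure ℝ).restrict I)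
      (AddCircle.haarAddCircle : Measure UnitAddCircle) := by
    have h := AddCircle.measurePreserving_mk (1 : ℝ) (-(1 / 2))
    rwa [AddCircle.volume_eq_smul_haarAddCircle, ENNReal.ofReal_one, one_smul] at h
  have hmk : MeasurePreserving (fun (x : Fin 3 → ℝ) (k : Fin 3) => ((x k : ℝ) : UnitAddCircle))
      (Measure.pi fun _ : Fin 3 => (volume : Measure ℝ).restrict I)
      (Measure.pi fun _ : Fin 3 => (AddCircle.haarAddCircle : Measure UnitAddCircle)) :=
    measurePreserving_pi (fun _ : Fin 3 => (volume : Measure ℝ).restrict I)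
      (fun _ : Fin 3 => (AddCircle.haarAddCircle : Measure UnitAddCircle)) fun _ => hmk1
  have hpi : (Measure.pi fun _ : Fin 3 => (volume : Measure ℝ).restrict I) =
      (volume : Measure (Fin 3 → ℝ)).restrict (Set.pi univ fun _ => I) := by
    rw [volume_pi, ← Measure.restrict_pi_pi]
  have hKc : MeasurableSet {p : UnitAddTorus (Fin 3) | ∑ k, ‖p k‖ ^ 2 ≤ r ^ 2} :=
    measurableSet_le (by fun_prop) measurable_const
  rw [← hmk.measure_preimage hKc.nullMeasurableSet, hpi, Measure.restrict_apply (hmk.measurable hKc)]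
  calc volume ((fun (x : Fin 3 → ℝ) (k : Fin 3) => ((x k : ℝ) : UnitAddCircle)) ⁻¹'
          {p | ∑ k, ‖p k‖ ^ 2 ≤ r ^ 2} ∩ Set.pi univ fun _ => I)
      ≤ volume {x : Fin 3 → ℝ | ∑ k, x k ^ 2 ≤ r ^ 2} := by
        refine measure_mono fun x hx => ?_
        obtain ⟨hx1, hx2⟩ := hx
        simp only [mem_preimage, mem_setOf_eq] at hx1
        have hxk : ∀ k, x k ∈ I := fun k => hx2 k (mem_univ k)
        simp only [mem_setOf_eq]
        calc ∑ k, x k ^ 2 = ∑ k, ‖((x k : ℝ) : UnitAddCircle)‖ ^ 2 := Finset.sum_congr rfl fun k _ => by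
                rw [(AddCircle.norm_coe_eq_abs_iff (1 : ℝ) one_ne_zero).2 ?_, sq_abs]
                rw [abs_one, abs_le]
                obtain ⟨h1, h2⟩ := hxk k
                constructor <;> linarith
          _ ≤ r ^ 2 := hx1
    _ = volume (Metric.closedBall (0 : EuclideanSpace ℝ (Fin 3)) r) := by
        rw [← (PiLp.volume_preserving_toLp (Fin 3)).measure_preimage measurableSet_closedBall.nullMeasurableSet,
          EuclideanSpace.closedBall_zero_eq r hr]
        rfl
    _ = ENNReal.ofReal r ^ 3 * ENNReal.ofReal (Real.pi * 4 / 3) := EuclideanSpace.volume_closedBall_fin_three 0 r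

/-- **A free parking spot exists**: finitely many points `S` of `(ℝ/ℤ)³` with `#S · (4π/3)b³ < 1` leave a
point at nearest-image distance `> b` from all of them (the closed `b`-balls have total Haar measure `< 1`).
[folklore] -/
theorem exists_far {b : ℝ} (hb : 0 ≤ b) (S : Finset (UnitAddTorus (Fin 3)))
    (hS : (S.card : ℝ) * (4 / 3 * Real.pi * b ^ 3) < 1) :
    ∃ p : UnitAddTorus (Fin 3), ∀ q ∈ S, b ^ 2 < ∑ k, ‖p k - q k‖ ^ 2 := by
  set Bad : Set (UnitAddTorus (Fin 3)) := ⋃ q ∈ S, {p | ∑ k, ‖p k - q k‖ ^ 2 ≤ b ^ 2} with hBad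
  have hlt : Measure.pi (fun _ : Fin 3 => (AddCircle.haarAddCircle : Measure UnitAddCircle)) Bad < 1 := by
    calc Measure.pi (fun _ : Fin 3 => (AddCircle.haarAddCircle : Measure UnitAddCircle)) Bad
        ≤ ∑ q ∈ S, Measure.pi (fun _ : Fin 3 => (AddCircle.haarAddCircle : Measure UnitAddCircle))
            {p | ∑ k, ‖p k - q k‖ ^ 2 ≤ b ^ 2} := measure_biUnion_finset_le S _
      _ ≤ ∑ q ∈ S, ENNReal.ofReal b ^ 3 * ENNReal.ofReal (Real.pi * 4 / 3) :=
          Finset.sum_le_sum fun q _ => haar_normBall_le q hb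
      _ = ENNReal.ofReal ((S.card : ℝ) * (4 / 3 * Real.pi * b ^ 3)) := by
          rw [Finset.sum_const, nsmul_eq_mul, ENNReal.ofReal_mul (Nat.cast_nonneg _), ENNReal.ofReal_natCast,
            show 4 / 3 * Real.pi * b ^ 3 = b ^ 3 * (Real.pi * 4 / 3) by ring,
            ENNReal.ofReal_mul (pow_nonneg hb 3), ENNReal.ofReal_pow hb]
      _ < 1 := ENNReal.ofReal_lt_one.2 hS
  have hne : (Badᶜ).Nonempty := by
    refine nonempty_of_measure_ne_zero
      (μ := Measure.pi (fun _ : Fin 3 => (AddCircle.haarAddCircle : Measure UnitAddCircle))) fun h0 => ?_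
    have h := measure_univ_le_add_compl Bad
      (μ := Measure.pi (fun _ : Fin 3 => (AddCircle.haarAddCircle : Measure UnitAddCircle)))
    rw [h0, add_zero, measure_univ] at h
    exact absurd hlt (not_lt.2 h)
  obtain ⟨p, hp⟩ := hne
  refine ⟨p, fun q hq => ?_⟩
  by_contra hle
  exact hp (mem_iUnion₂.2 ⟨q, hq, not_lt.1 hle⟩)

/-- The free region `{t | ∀ j ≠ l, b < ρⱼₗ(t)}` is open. [folklore] -/
theorem isOpen_free (b : ℝ) :
    IsOpen {t : UnitAddTorus (Fin N × Fin 3) | ∀ j l : Fin N, j ≠ l → b < Torus.pairDist j l t} := by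
  have hset : {t : UnitAddTorus (Fin N × Fin 3) | ∀ j l : Fin N, j ≠ l → b < Torus.pairDist j l t} =
      ⋂ j : Fin N, ⋂ l : Fin N, {t | j ≠ l → b < Torus.pairDist j l t} := by
    ext t
    simp only [mem_iInter, mem_setOf_eq]
  rw [hset]
  refine isOpen_iInter_of_finite fun j => isOpen_iInter_of_finite fun l => ?_
  by_cases h : j = l
  · have : {t : UnitAddTorus (Fin N × Fin 3) | j ≠ l → b < Torus.pairDist j l t} = univ :=
      eq_univ_of_forall fun t => by
        intro hjl
        exact absurd h hjl
    rw [this]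
    exact isOpen_univ
  · have : {t : UnitAddTorus (Fin N × Fin 3) | j ≠ l → b < Torus.pairDist j l t} =
        {t | b < Torus.pairDist j l t} := by
      ext t
      exact ⟨fun ht => ht h, fun ht _ => ht⟩
    rw [this]
    exact isOpen_lt continuous_const (Torus.continuous_pairDist j l)

/-- **Parking configuration.** Under the room condition `2N · (4π/3)b³ < 1`, for any two configurations `X`, `Y`
there is a free configuration `P` of parking spots such that spot `j` is `b`-far from the particles `l > j` of `X`
and spot `l` is `b`-far from the particles `j < l` of `Y` (chosen one at a time, spot `n` avoiding the `≤ 2N - 2`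
closed `b`-balls around `p_j, y_j (j < n)` and `x_l (l > n)`). [folklore] -/
theorem exists_parking {b : ℝ} (hb : 0 ≤ b) (hroom : 2 * (N : ℝ) * (4 / 3 * Real.pi * b ^ 3) < 1)
    (X Y : UnitAddTorus (Fin N × Fin 3)) :
    ∃ P : UnitAddTorus (Fin N × Fin 3),
      P ∈ {t : UnitAddTorus (Fin N × Fin 3) | ∀ j l : Fin N, j ≠ l → b < Torus.pairDist j l t} ∧
      (∀ j l : Fin N, j < l → b ^ 2 < ∑ k, ‖P (j, k) - X (l, k)‖ ^ 2) ∧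
      (∀ j l : Fin N, j < l → b ^ 2 < ∑ k, ‖Y (j, k) - P (l, k)‖ ^ 2) := by
  suffices h : ∀ n : ℕ, ∃ P : UnitAddTorus (Fin N × Fin 3),
      (∀ j l : Fin N, (j : ℕ) < n → (l : ℕ) < n → j ≠ l → b ^ 2 < ∑ k, ‖P (j, k) - P (l, k)‖ ^ 2) ∧
      (∀ j l : Fin N, (j : ℕ) < n → j < l → b ^ 2 < ∑ k, ‖P (j, k) - X (l, k)‖ ^ 2) ∧
      (∀ j l : Fin N, (l : ℕ) < n → j < l → b ^ 2 < ∑ k, ‖Y (j, k) - P (l, k)‖ ^ 2) by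
    obtain ⟨P, h1, h2, h3⟩ := h N
    refine ⟨P, fun j l hjl => ?_, fun j l hjl => h2 j l j.2 hjl, fun j l hjl => h3 j l l.2 hjl⟩
    exact (Real.lt_sqrt hb).2 (h1 j l j.2 l.2 hjl)
  intro n
  induction n with
  | zero =>
    exact ⟨X, fun j l hj => absurd hj (Nat.not_lt_zero _), fun j l hj => absurd hj (Nat.not_lt_zero _),
      fun j l hl => absurd hl (Nat.not_lt_zero _)⟩
  | succ n ih =>
    obtain ⟨P, h1, h2, h3⟩ := ih
    by_cases hn : n < N
    swap
    · exact ⟨P, fun j l _ _ hjl => h1 j l (by omega) (by omega) hjl, fun j l _ hjl => h2 j l (by omega) hjl,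
        fun j l _ hjl => h3 j l (by omega) hjl⟩
    set i : Fin N := ⟨n, hn⟩ with hi
    -- the points to avoid
    set S : Finset (UnitAddTorus (Fin 3)) :=
      ((Finset.univ.filter fun j : Fin N => (j : ℕ) < n).image fun j k => P (j, k)) ∪
      (((Finset.univ.filter fun l : Fin N => n < (l : ℕ)).image fun l k => X (l, k)) ∪
       ((Finset.univ.filter fun j : Fin N => (j : ℕ) < n).image fun j k => Y (j, k))) with hS
    have hcard : (S.card : ℝ) ≤ 2 * N := by
      have hA : (Finset.univ.filter fun j : Fin N => (j : ℕ) < n).card +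
          (Finset.univ.filter fun l : Fin N => n < (l : ℕ)).card ≤ N := by
        rw [← Finset.card_union_of_disjoint]
        · exact (Finset.card_le_univ _).trans_eq (Fintype.card_fin N)
        · rw [Finset.disjoint_filter]
          intro x _ h1 h2
          omega
      have hB : (Finset.univ.filter fun j : Fin N => (j : ℕ) < n).card ≤ N :=
        (Finset.card_le_univ _).trans_eq (Fintype.card_fin N)
      have hc : S.card ≤ 2 * N :=
        calc S.card ≤ _ + _ := Finset.card_union_le _ _
        _ ≤ _ + (_ + _) := Nat.add_le_add_left (Finset.card_union_le _ _) _
        _ ≤ (Finset.univ.filter fun j : Fin N => (j : ℕ) < n).card +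
            ((Finset.univ.filter fun l : Fin N => n < (l : ℕ)).card +
              (Finset.univ.filter fun j : Fin N => (j : ℕ) < n).card) :=
            Nat.add_le_add Finset.card_image_le (Nat.add_le_add Finset.card_image_le Finset.card_image_le)
        _ ≤ 2 * N := by omega
      exact_mod_cast hc
    have hS' : (S.card : ℝ) * (4 / 3 * Real.pi * b ^ 3) < 1 :=
      lt_of_le_of_lt (mul_le_mul_of_nonneg_right hcard (by positivity)) hroom
    obtain ⟨p, hp⟩ := exists_far hb S hS'
    have hpP : ∀ j : Fin N, (j : ℕ) < n → b ^ 2 < ∑ k, ‖p k - P (j, k)‖ ^ 2 := fun j hj => hp (fun k => P (j, k)) (by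
      rw [hS]
      exact Finset.mem_union_left _ (Finset.mem_image.2 ⟨j, Finset.mem_filter.2 ⟨Finset.mem_univ _, hj⟩, rfl⟩))
    have hpX : ∀ l : Fin N, n < (l : ℕ) → b ^ 2 < ∑ k, ‖p k - X (l, k)‖ ^ 2 := fun l hl => hp (fun k => X (l, k)) (by
      rw [hS]
      exact Finset.mem_union_right _ (Finset.mem_union_left _
        (Finset.mem_image.2 ⟨l, Finset.mem_filter.2 ⟨Finset.mem_univ _, hl⟩, rfl⟩)))
    have hpY : ∀ j : Fin N, (j : ℕ) < n → b ^ 2 < ∑ k, ‖p k - Y (j, k)‖ ^ 2 := fun j hj => hp (fun k => Y (j, k)) (by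
      rw [hS]
      exact Finset.mem_union_right _ (Finset.mem_union_right _
        (Finset.mem_image.2 ⟨j, Finset.mem_filter.2 ⟨Finset.mem_univ _, hj⟩, rfl⟩)))
    -- the new parking configuration: slot `i` of `P` moved to `p`
    set P' : UnitAddTorus (Fin N × Fin 3) := P + slotShift i (p - fun k => P (i, k)) with hP'
    have hP'i : ∀ k, P' (i, k) = p k := by
      intro k
      simp only [hP', Pi.add_apply, slotShift_apply_same, Pi.sub_apply]
      abel
    have hP'j : ∀ j, j ≠ i → ∀ k, P' (j, k) = P (j, k) := by
      intro j hj k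
      simp only [hP', Pi.add_apply, slotShift_apply_of_ne hj, add_zero]
    have hval : ∀ j : Fin N, j ≠ i → (j : ℕ) ≠ n := fun j hj h => hj (Fin.ext h)
    refine ⟨P', ?_, ?_, ?_⟩
    · intro j l hj hl hjl
      rcases eq_or_ne j i with rfl | hji
      · simp only [hP'i, hP'j l hjl.symm]
        have := hval l hjl.symm
        exact hpP l (by omega)
      rcases eq_or_ne l i with rfl | hli
      · simp only [hP'i, hP'j j hji]
        rw [sum_norm_sub_sq_comm]
        have := hval j hji
        exact hpP j (by omega)
      · simp only [hP'j j hji, hP'j l hli]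
        have := hval j hji
        have := hval l hli
        exact h1 j l (by omega) (by omega) hjl
    · intro j l hj hjl
      rcases eq_or_ne j i with rfl | hji
      · simp only [hP'i]
        exact hpX l hjl
      · simp only [hP'j j hji]
        have := hval j hji
        exact h2 j l (by omega) hjl
    · intro j l hl hjl
      rcases eq_or_ne l i with rfl | hli
      · simp only [hP'i]
        rw [sum_norm_sub_sq_comm]
        exact hpY j hjl
      · simp only [hP'j l hli]
        have := hval l hli
        exact h3 j l (by omega) hjl

end Spots

section Chains

/-- A splice `(a₀, …, a_{k-1}, b_k, …)` with `k ≥ N` is `A`. [folklore] -/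
theorem splice_of_le {k : ℕ} (hk : N ≤ k) (A B : UnitAddTorus (Fin N × Fin 3)) :
    (fun p : Fin N × Fin 3 => if (p.1 : ℕ) < k then A p else B p) = A := by
  ext p
  simp [lt_of_lt_of_le p.1.2 hk]

/-- One more spliced slot is a one-slot shift. [folklore] -/
theorem splice_succ (k : ℕ) (hk : k < N) (A B : UnitAddTorus (Fin N × Fin 3)) :
    (fun p : Fin N × Fin 3 => if (p.1 : ℕ) < k + 1 then A p else B p) =
      (fun p : Fin N × Fin 3 => if (p.1 : ℕ) < k then A p else B p) +
        slotShift ⟨k, hk⟩ (fun k' => A (⟨k, hk⟩, k') - B (⟨k, hk⟩, k')) := by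
  ext ⟨j, k'⟩
  rw [Pi.add_apply]
  by_cases hj : j = ⟨k, hk⟩
  · subst hj
    simp only [lt_add_iff_pos_right, Nat.lt_one_iff, if_true, lt_self_iff_false, if_false,
      slotShift_apply_same]
    abel
  · rw [slotShift_apply_of_ne hj, add_zero]
    dsimp only
    have hne : (j : ℕ) ≠ k := fun h => hj (Fin.ext h)
    by_cases hjk : (j : ℕ) < k
    · rw [if_pos hjk, if_pos (by omega)]
    · rw [if_neg hjk, if_neg (by omega)]

/-- **Splices of two free configurations are free** when slot `j` of the first is `b`-far from slot `l > j` of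
the second. [folklore] -/
theorem free_splice {b : ℝ} (hb : 0 ≤ b) {A B : UnitAddTorus (Fin N × Fin 3)}
    (hA : A ∈ {t : UnitAddTorus (Fin N × Fin 3) | ∀ j l : Fin N, j ≠ l → b < Torus.pairDist j l t})
    (hB : B ∈ {t : UnitAddTorus (Fin N × Fin 3) | ∀ j l : Fin N, j ≠ l → b < Torus.pairDist j l t})
    (hAB : ∀ j l : Fin N, j < l → b ^ 2 < ∑ k, ‖A (j, k) - B (l, k)‖ ^ 2) (k : ℕ) :
    (fun p : Fin N × Fin 3 => if (p.1 : ℕ) < k then A p else B p) ∈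
      {t : UnitAddTorus (Fin N × Fin 3) | ∀ j l : Fin N, j ≠ l → b < Torus.pairDist j l t} := by
  intro j l hjl
  have hA' := hA j l hjl
  have hB' := hB j l hjl
  unfold Torus.pairDist at hA' hB' ⊢
  by_cases hj : (j : ℕ) < k <;> by_cases hl : (l : ℕ) < k <;> simp only [hj, hl, if_true, if_false]
  · exact hA'
  · exact (Real.lt_sqrt hb).2 (hAB j l (by rw [Fin.lt_def]; omega))
  · rw [sum_norm_sub_sq_comm]
    exact (Real.lt_sqrt hb).2 (hAB l j (by rw [Fin.lt_def]; omega))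
  · exact hB'

/-- **Parking chains**: under the room condition, any two free configurations `X`, `Y` are joined by a finite chain
`X = C₀, C₁, …, C_M = Y` of free configurations, consecutive ones differing by a one-slot shift (the splices
`(p₀, …, p_{m-1}, x_m, …)` for `m ≤ N`, then `(y₀, …, y_{m-N-1}, p_{m-N}, …)` for `N ≤ m ≤ 2N`). [folklore] -/
theorem exists_chain {b : ℝ} (hb : 0 ≤ b) (hroom : 2 * (N : ℝ) * (4 / 3 * Real.pi * b ^ 3) < 1)
    {X Y : UnitAddTorus (Fin N × Fin 3)}
    (hX : X ∈ {t : UnitAddTorus (Fin N × Fin 3) | ∀ j l : Fin N, j ≠ l → b < Torus.pairDist j l t})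
    (hY : Y ∈ {t : UnitAddTorus (Fin N × Fin 3) | ∀ j l : Fin N, j ≠ l → b < Torus.pairDist j l t}) :
    ∃ (M : ℕ) (C : ℕ → UnitAddTorus (Fin N × Fin 3)), C 0 = X ∧ C M = Y ∧
      (∀ m, m ≤ M → C m ∈ {t : UnitAddTorus (Fin N × Fin 3) | ∀ j l : Fin N, j ≠ l → b < Torus.pairDist j l t}) ∧
      ∀ m, m < M → ∃ (i : Fin N) (c : UnitAddTorus (Fin 3)), C (m + 1) = C m + slotShift i c := by
  obtain ⟨P, hP, hPX, hYP⟩ := exists_parking hb hroom X Y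
  refine ⟨2 * N, fun m => if m ≤ N then (fun p : Fin N × Fin 3 => if (p.1 : ℕ) < m then P p else X p)
      else (fun p : Fin N × Fin 3 => if (p.1 : ℕ) < m - N then Y p else P p), ?_, ?_, ?_, ?_⟩
  · simp only [zero_le, if_true, Nat.not_lt_zero, if_false]
  · by_cases hN : N = 0
    · subst hN
      simp only [mul_zero, le_refl, if_true, Nat.not_lt_zero, if_false]
      ext ⟨j, _⟩
      exact j.elim0
    · have h2N : ¬ 2 * N ≤ N := by omega
      simp only [h2N, if_false]
      rw [show 2 * N - N = N by omega]
      exact splice_of_le le_rfl Y P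
  · intro m hm
    by_cases h : m ≤ N
    · simp only [h, if_true]
      exact free_splice hb hP hX hPX m
    · simp only [h, if_false]
      exact free_splice hb hY hP hYP (m - N)
  · intro m hm
    dsimp only
    by_cases h1 : m + 1 ≤ N
    · have h0 : m ≤ N := by omega
      rw [if_pos h0, if_pos h1]
      exact ⟨⟨m, by omega⟩, _, splice_succ m (by omega) P X⟩
    · -- from `C m = (y₀, …, y_{m-N-1}, p_{m-N}, …)` (for `m = N` this is `P = C N`) one more slot of `Y`
      have hCm : (if m ≤ N then (fun p : Fin N × Fin 3 => if (p.1 : ℕ) < m then P p else X p)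
          else (fun p : Fin N × Fin 3 => if (p.1 : ℕ) < m - N then Y p else P p)) =
          fun p : Fin N × Fin 3 => if (p.1 : ℕ) < m - N then Y p else P p := by
        by_cases h0 : m ≤ N
        · have hmN : m = N := by omega
          subst hmN
          simp only [le_refl, if_true, Nat.sub_self, Nat.not_lt_zero, if_false]
          exact splice_of_le le_rfl P X
        · simp only [h0, if_false]
      rw [hCm, if_neg h1, show m + 1 - N = (m - N) + 1 by omega]
      exact ⟨⟨m - N, by omega⟩, _, splice_succ (m - N) (by omega) Y P⟩

end Chains

end Summit.AtomisticToContinuum.BoseEinsteinCondensation.Cruxes.RewardChordBound.Birth.FreeRegionSpreading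

namespace Summit.AtomisticToContinuum.BoseEinsteinCondensation.Cruxes.RewardChordBound.Birth

/-- **Sub-goal `stub_freeRegionSpreadingChain` of stub R3** (registered helper of `stub_freeRegionSpreading`,
`FreeRegionSpreading.exists_chain` with the free region written out): under the parking room `2N·(4π/3)b³ < 1`
any two configurations of the free region `{∀ j ≠ l, b < ρⱼₗ}` are joined by a finite chain of configurations of
the free region, consecutive ones differing by a one-slot shift. [folklore] -/
theorem stub_freeRegionSpreadingChain :
    ∀ (N : ℕ) (b : ℝ), 0 ≤ b → 2 * (N : ℝ) * (4 / 3 * Real.pi * b ^ 3) < 1 → ∀ X Y : UnitAddTorus (Fin N × Fin 3), (∀ j l : Fin N, j ≠ l → b < Literature.Analysis.FunctionSpaces.Torus.pairDist j l X) → (∀ j l : Fin N, j ≠ l → b < Literature.Analysis.FunctionSpaces.Torus.pairDist j l Y) → ∃ (M : ℕ) (C : ℕ → UnitAddTorus (Fin N × Fin 3)), C 0 = X ∧ C M = Y ∧ (∀ m, m ≤ M → ∀ j l : Fin N, j ≠ l → b < Literature.Analysis.FunctionSpaces.Torus.pairDist j l (C m)) ∧ ∀ m, m < M → ∃ (i :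 Fin N) (c : UnitAddTorus (Fin 3)), C (m + 1) = C m + Literature.MathematicalPhysics.QuantumManyBody.BoseGas.slotShift i c :=
  fun _ _ hb hroom _ _ hX hY => FreeRegionSpreading.exists_chain hb hroom hX hY

end Summit.AtomisticToContinuum.BoseEinsteinCondensation.Cruxes.RewardChordBound.Birth

end
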